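import Summits.NavierStokesRegularity.NavierStokesRegularity.Theorems.ForcedSymmetry.Negative.WithoutOseen

/-!
# Crux `ForcedSymmetry` (stmt-NavierStokesRegularity-4052), negative side: discrete self-similarity does not force a continuous symmetry

Negative-side (cdisprove, D-0016, cycle 2) lemmas extracted from `Cruxes/ForcedSymmetry/Disproof.lean`
v8 §10.  The real threat to the crux is a backward DISCRETELY self-similar Type-I ancient solution that
is not (rotated-)self-similar (Bradshaw–Tsai 2017, Open Problem 5.1; Chae–Wolf 2017 remove only
`λ ≈ 1`).  Its kinematic shadow is checkable: in the H3-free class (smooth, divergence free, Type-I rate)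
there are λ-DSS fields with TRIVIAL `sim(3)`-stabiliser, so the typed side clauses of the crux together
with discrete self-similarity do not produce its `∃ ξ` — only the Oseen identity of `u` itself could.

* `coords_eq_zero_of_R`, `rigid_of_R` — the rigidity computation of `Negative/WithoutOseen.lean`
  (`coords_eq_zero`, `w_rigid`) with the defect hypothesis abstracted: `R a A ≡ 0` with `A` skew forces
  `a = 0`, `A = 0` (reusable with any clock); `DV_add_defect_eq`;
* the witness `ud t x = dm t · sr t · V (sr t • x)`, `dm t = 2 + sin log(−t)`, `sr t = (−t)^{-1/2}`,
  `V` the Gaussian two-vortex profile of `Negative/Witness.lean`: `ud_dss` (λ-DSS with `λ = e^{π}`),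
  `ud_h1`, `ud_h2`, `ud_h4` (H1, H2, H4 with `C = 6`), `simGen_ud` / `ud_key` (the generator on the
  slices), `ud_rigid` (trivial stabiliser), `dss_does_not_force_symmetry`, and the named corollary
  `exists_dss_symmetryFree` (a λ-DSS member of the H3-free class with trivial stabiliser; the bare
  `¬ ForcedSymmetryWithoutH3` is already `forcedSymmetry_false_without_H3` of `Negative/WithoutOseen.lean`).
  The EXTENDED stabiliser (`⟨∂ₜ⟩ ⊕ sim(3)`) is handled in the sibling file `Negative/DSSWitnessExtended.lean`.

No statement of the route is changed; nothing here closes the item (`--supports`).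
-/

noncomputable section

namespace Summit.NavierStokesRegularity.NavierStokesRegularity.Theorems.ForcedSymmetry.Negative

open MeasureTheory Set Filter Topology
open Literature.Analysis.FluidPDE Literature.Analysis.UnboundedOperators
open Summit.NavierStokesRegularity.NavierStokesRegularity.Theses.SymmetryModuliCount
open Summit.NavierStokesRegularity.NavierStokesRegularity.Theorems.MustSqueeze.Negative

/-! ## Rigidity from the polynomial defect -/

section RigidOfR

variable {a : EuclideanSpace ℝ (Fin 3)} {A : EuclideanSpace ℝ (Fin 3) →L[ℝ] EuclideanSpace ℝ (Fin 3)}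

/-- The polynomial symmetry defect `R a A` of the profile `V` determines `(a, A)`: if `A` is skew and
`R a A ≡ 0` then all twelve coordinates of `(a, A e₀, A e₁, A e₂)` vanish (the computation inside
`coords_eq_zero`, with the defect hypothesis abstracted so that other clocks can reuse it). -/
theorem coords_eq_zero_of_R (hA : ∀ x, inner ℝ (A x) x = 0) (hR : ∀ x, R a A x = 0) :
    (a 0 = 0 ∧ a 1 = 0 ∧ a 2 = 0) ∧ (A e0 0 = 0 ∧ A e0 1 = 0 ∧ A e0 2 = 0) ∧
      (A e1 0 = 0 ∧ A e1 1 = 0 ∧ A e1 2 = 0) ∧ (A e2 0 = 0 ∧ A e2 1 = 0 ∧ A e2 2 = 0) := by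
  have d0 : A e0 0 = 0 := skew_diag hA 0
  have d1 : A e1 1 = 0 := skew_diag hA 1
  have d2 : A e2 2 = 0 := skew_diag hA 2
  have o01 : A e1 0 = - A e0 1 := skew_off hA 0 1
  have o02 : A e2 0 = - A e0 2 := skew_off hA 0 2
  have o12 : A e2 1 = - A e1 2 := skew_off hA 1 2
  have r0 := hR 0
  have r2 := hR e2
  have r2' := hR (-e2)
  have r1 := hR e0
  simp only [R, map_zero, add_zero, P_zero, smul_zero, sub_zero, P_e2, P_neg_e2, map_neg, P_e0] at r0 r2 r2' r1
  have c00 := congrArg (fun v : EuclideanSpace ℝ (Fin 3) => v 0) r0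
  have c01 := congrArg (fun v : EuclideanSpace ℝ (Fin 3) => v 1) r0
  have c20 := congrArg (fun v : EuclideanSpace ℝ (Fin 3) => v 0) r2
  have c2'1 := congrArg (fun v : EuclideanSpace ℝ (Fin 3) => v 1) r2'
  have c11 := congrArg (fun v : EuclideanSpace ℝ (Fin 3) => v 1) r1
  have c12 := congrArg (fun v : EuclideanSpace ℝ (Fin 3) => v 2) r1
  simp only [DP_c0, DP_c1, DP_c2, PiLp.add_apply, PiLp.sub_apply, PiLp.neg_apply, PiLp.smul_apply,
    PiLp.zero_apply, smul_eq_mul, e0_c0, e0_c1, e0_c2, e1_c1, e1_c2, e2_c0, e2_c2,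
    inner_e0_left] at c00 c01 c20 c2'1 c11 c12
  have ha1 : a 1 = 0 := by linarith
  have ha0 : a 0 = 0 := by nlinarith
  have h21 : A e2 1 = 0 := by linarith
  have h20 : A e2 0 = 0 := by nlinarith
  have h02 : A e0 2 = 0 := by linarith
  have ha2 : a 2 = 0 := by nlinarith
  have h12 : A e1 2 = 0 := by linarith
  have h01 : A e0 1 = 0 := by nlinarith
  refine ⟨⟨ha0, ha1, ha2⟩, ⟨d0, h01, h02⟩, ⟨by linarith, d1, h12⟩, ⟨h20, h21, d2⟩⟩

/-- `R a A ≡ 0` with `A` skew forces `a = 0` and `A = 0`. -/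
theorem rigid_of_R (hA : ∀ x, inner ℝ (A x) x = 0) (hR : ∀ x, R a A x = 0) : a = 0 ∧ A = 0 := by
  obtain ⟨⟨ha0, ha1, ha2⟩, ⟨h00, h01, h02⟩, ⟨h10, h11, h12⟩, ⟨h20, h21, h22⟩⟩ := coords_eq_zero_of_R hA hR
  refine ⟨?_, ?_⟩
  · ext i; fin_cases i <;> simp [ha0, ha1, ha2]
  · have hA0 : A e0 = 0 := by ext i; fin_cases i <;> simp [h00, h01, h02]
    have hA1 : A e1 = 0 := by ext i; fin_cases i <;> simp [h10, h11, h12]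
    have hA2 : A e2 = 0 := by ext i; fin_cases i <;> simp [h20, h21, h22]
    refine ContinuousLinearMap.coe_inj.1 ((EuclideanSpace.basisFun (Fin 3) ℝ).toBasis.ext fun i => ?_)
    fin_cases i
    · simpa [e0] using hA0
    · simpa [e1] using hA1
    · simpa [e2] using hA2

/-- At `σ = 0` the defect of `V` is `DV y a + (DV y (A y) − A (V y)) = gauss y • R a A y`. -/
theorem DV_add_defect_eq (a : EuclideanSpace ℝ (Fin 3)) (A : EuclideanSpace ℝ (Fin 3) →L[ℝ] EuclideanSpace ℝ (Fin 3))
    (y : EuclideanSpace ℝ (Fin 3)) : DV y a + (DV y (A y) - A (V y)) = gauss y • R a A y := by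
  rw [← core_zero_sigma]
  simp only [core, zero_smul, add_zero, map_add]
  abel

end RigidOfR

/-! ### The λ-DSS witness `ud t x = (2 + sin log(−t)) (−t)^{-1/2} V(x/√(−t))` -/

/-- The log-periodic modulation `dm t = 2 + sin(log(−t))`. -/
def dm (t : ℝ) : ℝ := 2 + Real.sin (Real.log (-t))

/-- The similarity radius `sr t = (−t)^{-1/2}`. -/
def sr (t : ℝ) : ℝ := (Real.sqrt (-t))⁻¹

/-- **The λ-DSS witness** `ud t x = dm t · sr t · V (sr t • x)`: self-similar up to the log-periodic
factor `dm`, hence discretely self-similar with factor `λ = e^{π}` but NOT self-similar. -/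
def ud (t : ℝ) (x : EuclideanSpace ℝ (Fin 3)) : EuclideanSpace ℝ (Fin 3) := (dm t * sr t) • V (sr t • x)

/-- The similarity radius is positive on `t < 0`. -/
theorem sr_pos {t : ℝ} (ht : t < 0) : 0 < sr t := inv_pos.2 (Real.sqrt_pos.2 (by linarith))

/-- `|dm| ≤ 3`. -/
theorem abs_dm_le (t : ℝ) : |dm t| ≤ 3 := by
  have h1 := Real.sin_le_one (Real.log (-t))
  have h2 := Real.neg_one_le_sin (Real.log (-t))
  rw [dm, abs_le]; constructor <;> linarith

/-- `sr t · √(−t) = 1`. -/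
theorem sr_mul_sqrt {t : ℝ} (ht : t < 0) : sr t * Real.sqrt (-t) = 1 :=
  inv_mul_cancel₀ (Real.sqrt_pos.2 (by linarith)).ne'

/-- Discrete self-similarity: `ud (e^{2π} t) (e^{π} x) = e^{−π} ud t x` on `t < 0`. -/
theorem ud_dss {t : ℝ} (ht : t < 0) (x : EuclideanSpace ℝ (Fin 3)) :
    ud (Real.exp (2 * Real.pi) * t) (Real.exp Real.pi • x) = Real.exp (-Real.pi) • ud t x := by
  have hE : 0 < Real.exp (2 * Real.pi) := Real.exp_pos _
  have hdm : dm (Real.exp (2 * Real.pi) * t) = dm t := by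
    simp only [dm]
    rw [show -(Real.exp (2 * Real.pi) * t) = Real.exp (2 * Real.pi) * (-t) by ring,
      Real.log_mul hE.ne' (by linarith : -t ≠ 0), Real.log_exp, add_comm (2 * Real.pi), Real.sin_add_two_pi]
  have hsq : Real.sqrt (Real.exp (2 * Real.pi)) = Real.exp Real.pi := by
    rw [show Real.exp (2 * Real.pi) = Real.exp Real.pi ^ 2 by rw [← Real.exp_nat_mul]; ring_nf,
      Real.sqrt_sq (Real.exp_pos _).le]
  have hsr : sr (Real.exp (2 * Real.pi) * t) = Real.exp (-Real.pi) * sr t := by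
    simp only [sr]
    rw [show -(Real.exp (2 * Real.pi) * t) = Real.exp (2 * Real.pi) * (-t) by ring,
      Real.sqrt_mul hE.le, hsq, mul_inv, Real.exp_neg]
  simp only [ud, hdm, hsr, smul_smul]
  have h1 : Real.exp (-Real.pi) * sr t * Real.exp Real.pi = sr t := by
    rw [Real.exp_neg]; field_simp
  rw [h1]
  congr 1
  ring

/-! ### Derivatives -/

/-- Space derivative of the witness: `D(ud t)(x) = dm·sr² · DV(sr·x)`. -/
theorem hasFDerivAt_ud (t : ℝ) (x : EuclideanSpace ℝ (Fin 3)) :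
    HasFDerivAt (ud t) ((dm t * sr t * sr t) • DV (sr t • x)) x := by
  have h1 : HasFDerivAt (fun x : EuclideanSpace ℝ (Fin 3) => sr t • x) (sr t • ContinuousLinearMap.id ℝ _) x :=
    (hasFDerivAt_id x).const_smul (sr t)
  have h2 := ((hasFDerivAt_V (sr t • x)).comp x h1).const_smul (dm t * sr t)
  have he : (dm t * sr t) • (DV (sr t • x)).comp (sr t • ContinuousLinearMap.id ℝ (EuclideanSpace ℝ (Fin 3))) =
      (dm t * sr t * sr t) • DV (sr t • x) := by
    ext h
    simp [smul_smul, mul_comm, mul_left_comm]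
  rw [← he]
  exact h2

/-- `fderiv` form of `hasFDerivAt_ud`. -/
theorem fderiv_ud (t : ℝ) (x : EuclideanSpace ℝ (Fin 3)) :
    fderiv ℝ (ud t) x = (dm t * sr t * sr t) • DV (sr t • x) :=
  (hasFDerivAt_ud t x).fderiv

/-- `sr' = sr³/2`. -/
theorem hasDerivAt_sr {t : ℝ} (ht : t < 0) : HasDerivAt sr (sr t ^ 3 / 2) t := by
  have hq : 0 < Real.sqrt (-t) := Real.sqrt_pos.2 (by linarith)
  have h1 : HasDerivAt (fun s : ℝ => Real.sqrt (-s)) ((-1) / (2 * Real.sqrt (-t))) t :=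
    (hasDerivAt_neg t).sqrt (by linarith)
  have h2 := h1.inv hq.ne'
  have hval : -(-1 / (2 * Real.sqrt (-t))) / Real.sqrt (-t) ^ 2 = sr t ^ 3 / 2 := by
    simp only [sr]
    field_simp
  rw [hval] at h2
  exact h2

/-- `dm' t = cos(log(−t))/t`. -/
theorem hasDerivAt_dm {t : ℝ} (ht : t < 0) : HasDerivAt dm (Real.cos (Real.log (-t)) * t⁻¹) t := by
  have h1 : HasDerivAt (fun s : ℝ => Real.log (-s)) ((-t)⁻¹ * (-1)) t :=
    (Real.hasDerivAt_log (by linarith : -t ≠ 0)).comp t (hasDerivAt_neg t)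
  have h2 := (Real.hasDerivAt_sin _).comp t h1
  have h3 := h2.const_add 2
  have hval : Real.cos (Real.log (-t)) * ((-t)⁻¹ * -1) = Real.cos (Real.log (-t)) * t⁻¹ := by
    rw [inv_neg]; ring
  rw [hval] at h3
  exact h3

/-- Time derivative of the witness. -/
theorem hasDerivAt_ud_time {t : ℝ} (ht : t < 0) (x : EuclideanSpace ℝ (Fin 3)) :
    HasDerivAt (fun s => ud s x)
      ((dm t * sr t) • DV (sr t • x) ((sr t ^ 3 / 2) • x) +
        (Real.cos (Real.log (-t)) * t⁻¹ * sr t + dm t * (sr t ^ 3 / 2)) • V (sr t • x)) t := by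
  have hV : HasDerivAt (fun s => V (sr s • x)) (DV (sr t • x) ((sr t ^ 3 / 2) • x)) t := by
    have := (hasFDerivAt_V (sr t • x)).comp_hasDerivAt t ((hasDerivAt_sr ht).smul_const x)
    simpa [Function.comp_def] using this
  exact ((hasDerivAt_dm ht).mul (hasDerivAt_sr ht)).smul hV

/-- `timeDeriv` form of `hasDerivAt_ud_time`. -/
theorem timeDeriv_ud {t : ℝ} (ht : t < 0) (x : EuclideanSpace ℝ (Fin 3)) :
    timeDeriv ud t x = (dm t * sr t) • DV (sr t • x) ((sr t ^ 3 / 2) • x) +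
        (Real.cos (Real.log (-t)) * t⁻¹ * sr t + dm t * (sr t ^ 3 / 2)) • V (sr t • x) :=
  (hasDerivAt_ud_time ht x).deriv

/-! ### The witness satisfies H1, H2, H4 -/

/-- H1: the witness is smooth on `t < 0`. -/
theorem ud_h1 : H1 ud := by
  intro p hp
  have ht : p.1 < 0 := by simpa using hp.1
  have hsr : ContDiffAt ℝ (⊤ : ℕ∞) (fun q : ℝ × EuclideanSpace ℝ (Fin 3) => sr q.1) p := by
    have h1 : ContDiffAt ℝ (⊤ : ℕ∞) (fun q : ℝ × EuclideanSpace ℝ (Fin 3) => Real.sqrt (-q.1)) p :=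
      contDiffAt_fst.neg.sqrt (by simp; linarith)
    exact h1.inv (Real.sqrt_pos.2 (by simp; linarith)).ne'
  have hdm : ContDiffAt ℝ (⊤ : ℕ∞) (fun q : ℝ × EuclideanSpace ℝ (Fin 3) => dm q.1) p := by
    have h1 : ContDiffAt ℝ (⊤ : ℕ∞) (fun q : ℝ × EuclideanSpace ℝ (Fin 3) => Real.log (-q.1)) p :=
      contDiffAt_fst.neg.log (by simp; linarith)
    exact contDiffAt_const.add h1.sin
  have hV : ContDiffAt ℝ (⊤ : ℕ∞) (fun q : ℝ × EuclideanSpace ℝ (Fin 3) => V (sr q.1 • q.2)) p :=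
    contDiff_V.contDiffAt.comp p (hsr.smul contDiffAt_snd)
  exact ((hdm.mul hsr).smul hV).contDiffWithinAt

/-- `tr DV(y) = 0`: the profile `V` is divergence free. -/
theorem sum_inner_DV (y : EuclideanSpace ℝ (Fin 3)) :
    inner ℝ (EuclideanSpace.single 0 (1:ℝ) : EuclideanSpace ℝ (Fin 3)) (DV y (EuclideanSpace.single 0 1)) +
      inner ℝ (EuclideanSpace.single 1 (1:ℝ) : EuclideanSpace ℝ (Fin 3)) (DV y (EuclideanSpace.single 1 1)) +
      inner ℝ (EuclideanSpace.single 2 (1:ℝ) : EuclideanSpace ℝ (Fin 3)) (DV y (EuclideanSpace.single 2 1)) = 0 := by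
  simp only [inner_single_one_left, DV_apply, PiLp.add_apply, PiLp.smul_apply, smul_eq_mul, DP_c0, DP_c1, DP_c2,
    P_c0, P_c1, P_c2, PiLp.single_apply, EuclideanSpace.inner_single_right]
  simp
  ring

/-- H2: the witness is divergence free. -/
theorem ud_h2 : H2 ud := by
  intro t _ x
  have hb := divergence_eq_sum_inner_fderiv (EuclideanSpace.basisFun (Fin 3) ℝ) (ud t) x
  rw [hb, fderiv_ud, Fin.sum_univ_three]
  simp only [EuclideanSpace.basisFun_apply, smul_apply, real_inner_smul_right,
    ← mul_add]
  rw [sum_inner_DV, mul_zero]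

/-- H4: the Type-I rate with constant `6`. -/
theorem ud_h4 : H4 6 ud := by
  intro t ht x
  have hs := sr_pos ht
  have hq : 0 < Real.sqrt (-t) := Real.sqrt_pos.2 (by linarith)
  rw [ud, norm_smul, Real.norm_eq_abs, abs_mul, abs_of_pos hs]
  have h1 : |dm t| * sr t * ‖V (sr t • x)‖ ≤ 3 * sr t * 2 := by
    gcongr
    · exact abs_dm_le t
    · exact norm_V_le _
  refine h1.trans (le_of_eq ?_)
  rw [sr, div_eq_mul_inv]
  ring

/-! ### Trivial stabiliser -/

/-- The generator on the witness, evaluated at `x = √(−t) • y`: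
`√(−t) • L_ξ ud (t, √(−t)y) = dm t • (sr t • DV y a + (DV y (A y) − A (V y))) + (2σ cos log(−t)) • V y`. -/
theorem simGen_ud {t : ℝ} (ht : t < 0) (a : EuclideanSpace ℝ (Fin 3)) (σ : ℝ)
    (A : EuclideanSpace ℝ (Fin 3) →L[ℝ] EuclideanSpace ℝ (Fin 3)) (y : EuclideanSpace ℝ (Fin 3)) :
    Real.sqrt (-t) • simGen ud a σ A t (Real.sqrt (-t) • y) =
      dm t • (sr t • DV y a + (DV y (A y) - A (V y))) + (2 * σ * Real.cos (Real.log (-t))) • V y := by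
  set q : ℝ := Real.sqrt (-t) with hq_def
  have hq : 0 < q := Real.sqrt_pos.2 (by linarith)
  have hqq : q * q = -t := Real.mul_self_sqrt (by linarith)
  have hsq : sr t * q = 1 := sr_mul_sqrt ht
  have hsr : sr t = q⁻¹ := by rw [sr]
  have hy : sr t • (q • y) = y := by rw [smul_smul, hsq, one_smul]
  unfold simGen
  rw [fderiv_ud, timeDeriv_ud ht, hy]
  simp only [ud, hy, smul_apply, map_add, map_smul, smul_add, smul_sub, smul_smul]
  rw [hsr]
  have ht' : t = -(q * q) := by linarith
  have hq0 : q ≠ 0 := hq.ne'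
  rw [ht']
  match_scalars <;> field_simp <;> ring

variable {a : EuclideanSpace ℝ (Fin 3)} {σ : ℝ} {A : EuclideanSpace ℝ (Fin 3) →L[ℝ] EuclideanSpace ℝ (Fin 3)}

/-- The key identity on every slice: for `t < 0` and all `y`,
`dm t • (sr t • DV y a + (DV y (A y) − A (V y))) + (2σ cos log(−t)) • V y = 0`. -/
theorem ud_key (h : ∀ t < 0, ∀ x, simGen ud a σ A t x = 0) {t : ℝ} (ht : t < 0) (y : EuclideanSpace ℝ (Fin 3)) :
    dm t • (sr t • DV y a + (DV y (A y) - A (V y))) + (2 * σ * Real.cos (Real.log (-t))) • V y = 0 := by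
  rw [← simGen_ud ht, h t ht, smul_zero]

/-- `dm(−1) = 2`. -/
theorem dm_neg_one : dm (-1) = 2 := by simp [dm]
/-- `sr(−1) = 1`. -/
theorem sr_neg_one : sr (-1) = 1 := by simp [sr]
/-- Phase at `t = −1`. -/
theorem cos_log_neg_neg_one : Real.cos (Real.log (-(-1 : ℝ))) = 1 := by simp

/-- `dm(−e^{2π}) = 2` (same phase as `t = −1`). -/
theorem dm_t1 : dm (-Real.exp (2 * Real.pi)) = 2 := by
  simp [dm, Real.log_exp]
/-- Phase at `t = −e^{2π}`. -/
theorem cos_t1 : Real.cos (Real.log (-(-Real.exp (2 * Real.pi)))) = 1 := by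
  simp [Real.log_exp]
/-- The radius at `t = −e^{2π}` differs from the one at `t = −1`. -/
theorem sr_t1_ne_one : sr (-Real.exp (2 * Real.pi)) ≠ 1 := by
  simp only [sr, neg_neg]
  intro h
  have h1 : Real.sqrt (Real.exp (2 * Real.pi)) = 1 := by
    rw [← inv_inv (Real.sqrt _), h, inv_one]
  rw [Real.sqrt_eq_one, Real.exp_eq_one_iff] at h1
  have := Real.pi_pos
  linarith

/-- `dm(−e^{π/2}) = 3`. -/
theorem dm_t2 : dm (-Real.exp (Real.pi / 2)) = 3 := by
  simp [dm, Real.log_exp]; norm_num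
/-- Stationary phase at `t = −e^{π/2}`. -/
theorem cos_t2 : Real.cos (Real.log (-(-Real.exp (Real.pi / 2)))) = 0 := by
  simp [Real.log_exp]

/-- Step A: `DV y a = 0` for all `y` (slices `t = −1` and `t = −e^{2π}`: same phase, different radius). -/
theorem ud_DVa (h : ∀ t < 0, ∀ x, simGen ud a σ A t x = 0) (y : EuclideanSpace ℝ (Fin 3)) : DV y a = 0 := by
  have k0 := ud_key h (by norm_num : (-1 : ℝ) < 0) y
  have k1 := ud_key h (by have := Real.exp_pos (2 * Real.pi); linarith : -Real.exp (2 * Real.pi) < 0) y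
  rw [dm_neg_one, sr_neg_one, cos_log_neg_neg_one] at k0
  rw [dm_t1, cos_t1] at k1
  have hd : ((2 : ℝ) * (1 - sr (-Real.exp (2 * Real.pi)))) • DV y a = 0 := by
    have : ((2 : ℝ) * (1 - sr (-Real.exp (2 * Real.pi)))) • DV y a =
        ((2 : ℝ) • ((1 : ℝ) • DV y a + (DV y (A y) - A (V y))) + (2 * σ * 1) • V y) -
          ((2 : ℝ) • (sr (-Real.exp (2 * Real.pi)) • DV y a + (DV y (A y) - A (V y))) + (2 * σ * 1) • V y) := by
      module
    rw [this, k0, k1, sub_zero]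
  rcases smul_eq_zero.1 hd with hc | hv
  · exfalso
    have hne : (1 : ℝ) - sr (-Real.exp (2 * Real.pi)) ≠ 0 := sub_ne_zero.2 (Ne.symm sr_t1_ne_one)
    rcases mul_eq_zero.1 hc with h2 | h2
    · norm_num at h2
    · exact hne h2
  · exact hv

/-- Step B: the rotational defect vanishes, `DV y (A y) = A (V y)` (slice `t = −e^{π/2}`, where the
modulation is stationary). -/
theorem ud_defect (h : ∀ t < 0, ∀ x, simGen ud a σ A t x = 0) (y : EuclideanSpace ℝ (Fin 3)) :
    DV y (A y) - A (V y) = 0 := by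
  have k2 := ud_key h (by have := Real.exp_pos (Real.pi / 2); linarith : -Real.exp (Real.pi / 2) < 0) y
  rw [dm_t2, cos_t2, ud_DVa h y, smul_zero, zero_add, mul_zero, zero_smul, add_zero] at k2
  exact (smul_eq_zero.1 k2).resolve_left (by norm_num)

/-- Step C: the scaling component vanishes (slice `t = −1` at `y = e₀`, where `V e₀ ≠ 0`). -/
theorem ud_sigma (h : ∀ t < 0, ∀ x, simGen ud a σ A t x = 0) : σ = 0 := by
  have k0 := ud_key h (by norm_num : (-1 : ℝ) < 0) e0
  rw [dm_neg_one, sr_neg_one, cos_log_neg_neg_one, ud_DVa h e0, ud_defect h e0, smul_zero, zero_add, smul_zero,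
    zero_add, V_e0, smul_smul] at k0
  have h1 := (smul_eq_zero.1 k0).resolve_right e1_ne_zero
  have hg := (gauss_pos e0).ne'
  rcases mul_eq_zero.1 h1 with h2 | h2
  · linarith [show σ = 0 from by nlinarith [mul_eq_zero.1 h2]]
  · exact absurd h2 hg

/-- **Rigidity of the λ-DSS witness**: its `sim(3)`-stabiliser is trivial. -/
theorem ud_rigid (hA : ∀ x, inner ℝ (A x) x = 0) (h : ∀ t < 0, ∀ x, simGen ud a σ A t x = 0) :
    a = 0 ∧ σ = 0 ∧ A = 0 := by
  have hR : ∀ y, R a A y = 0 := fun y => by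
    have h1 : gauss y • R a A y = 0 := by
      rw [← DV_add_defect_eq, ud_DVa h y, ud_defect h y, add_zero]
    exact (smul_eq_zero.1 h1).resolve_left (gauss_pos y).ne'
  obtain ⟨ha, hA0⟩ := rigid_of_R hA hR
  exact ⟨ha, ud_sigma h, hA0⟩

/-- **Discrete self-similarity does not force a continuous symmetry** (kinematically): the λ-DSS
field `ud` (`λ = e^{π}`, `ud_dss`) is smooth on `t < 0`, divergence free, obeys the Type-I rate with
`C = 6`, and has NO nonzero infinitesimal similarity symmetry.  In particular it is another witness of
`¬ ForcedSymmetryWithoutH3` (`forcedSymmetry_false_without_H3`, `Negative/WithoutOseen.lean`), one that is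
discretely self-similar: the typed side clauses plus λ-DSS do not yield the crux's `∃ ξ`; a backward λ-DSS member of `A_C` with this symmetry type (Bradshaw–Tsai 2017
OP 5.1, existence open) would refute the crux and `X` at once. -/
theorem dss_does_not_force_symmetry :
    H1 ud ∧ H2 ud ∧ H4 6 ud ∧ (∀ t < 0, ∀ x, ud (Real.exp (2 * Real.pi) * t) (Real.exp Real.pi • x) = Real.exp (-Real.pi) • ud t x)
      ∧ ¬ HasSimSymmetry ud := by
  refine ⟨ud_h1, ud_h2, ud_h4, fun t ht x => ud_dss ht x, ?_⟩
  rintro ⟨a, σ, A, hA, hne, hL⟩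
  exact hne (ud_rigid hA hL)

/-- **Named corollary (the genuinely new content).** There is a λ-DSS field (`λ = e^{π}`) in the H3-free
class — smooth on `t < 0`, divergence free, Type-I with constant `6` — with NO nonzero infinitesimal
similarity symmetry. -/
theorem exists_dss_symmetryFree :
    ∃ u : ℝ → EuclideanSpace ℝ (Fin 3) → EuclideanSpace ℝ (Fin 3),
      (∀ t < 0, ∀ x, u (Real.exp (2 * Real.pi) * t) (Real.exp Real.pi • x) = Real.exp (-Real.pi) • u t x) ∧
        H1 u ∧ H2 u ∧ H4 6 u ∧ ¬ HasSimSymmetry u :=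
  ⟨ud, dss_does_not_force_symmetry.2.2.2.1, ud_h1, ud_h2, ud_h4, dss_does_not_force_symmetry.2.2.2.2⟩

end Summit.NavierStokesRegularity.NavierStokesRegularity.Theorems.ForcedSymmetry.Negative
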